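import Mathlib
import Literature.Probability.Process.PointStationaryLaw
import Literature.Probability.Process.RootedHardCoreConfig
import Summits.AtomisticToContinuum.Crystallization.Theorems.PalmUnimodularRigidityCruxesToPalmRigidity
import Summits.AtomisticToContinuum.Crystallization.Theorems.IsometryAtomsMinimisingLawsCohesiveFiniteOrbitsOfChargedAux1

/-!
# The Mecke mass formula for the orbit classes of a charged configuration

Auxiliary file 2 for stub `stub_finiteOrbitsOfCharged` of line `purity_stacking` of crux
`IsometryAtoms.MinimisingLawsCohesive` (stmt-AtomisticToContinuum-15777).  Notation of the comments
(the sets are written out in the statements, as in auxiliary file 1): for a point set `Y` of a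
finite-dimensional real normed space `E`,
`orbit b = {t | ∃ g : E ≃ᵢ E, g '' Y = Y ∧ g b = t}`, `cls p = {count|A(Y - p) | A : E →ₗᵢ[ℝ] E}`,
`K b = ⋃ p ∈ orbit b, cls p` (the orbit class of `b`), `n(a, b, r) = #(orbit b ∩ B̄(a, r))`,
`Stab b = {g | g '' Y = Y ∧ g b = b}`.

* `lintegral_indicator_klass_eq` — for a copy `ν = count|A(Y - q)`, the number of atoms `y` of `ν`
  with `θ_y ν ∈ K b` and `‖y‖ ≤ r` is `n(q, b, r)` (as a `lintegral` against `ν`).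
* `ncard_mul_measure_klass_eq` — **Mecke between orbit classes**: for a point-stationary law `P`
  almost surely `δ`-hard-core, `n(a, b, r) · P(K a) = n(b, a, r) · P(K b)` — the Mecke identity for
  the transport `g(μ, y) = 1[μ ∈ K a] 1[θ_y μ ∈ K b] 1[‖y‖ ≤ r]`, made jointly measurable through an
  s-finite kernel that is the identity on locally finite configurations
  (`PalmUnimodularRigidity.exists_isSFiniteKernel_apply_eq_self`, `measurable_map_sub_kernel`).
* `measure_klass_mul_card_stab_eq` — **the mass formula** `P(K a) · |Stab a| = P(K b) · |Stab b|`
  for all `a, b ∈ Y`, from the previous identity at `r = dist b a` and the count of moves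
  `#{g | dist (g b) a ≤ r} = n(a, b, r) |Stab b| = n(b, a, r) |Stab a| > 0` (auxiliary file 1).
-/

noncomputable section

open MeasureTheory ProbabilityTheory Set Metric
open scoped ENNReal

namespace Summit.AtomisticToContinuum.Crystallization.Theorems.IsometryAtomsMinimisingLawsCohesive.FiniteOrbitsOfCharged

open Literature.Probability.Process (IsPointStationaryLaw IsRootedHardCore map_sub_count_restrict
  count_restrict_singleton_ne_zero_iff)
open Summit.AtomisticToContinuum.Crystallization.Theorems.PalmUnimodularRigidity
  (exists_isSFiniteKernel_apply_eq_self measurable_map_sub_kernel measurableSet_floorNorm_preimage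
    count_restrict_floorNorm_preimage_lt_top)

/-! ## Countability and measurability -/

section Countable

variable {E : Type*} [NormedAddCommGroup E] [ProperSpace E]

/-- A `δ`-separated set (`δ > 0`) of a proper space is countable (it is finite in every ball). -/
theorem countable_of_forall_le_dist {Y : Set E} {δ : ℝ} (hδ : 0 < δ)
    (hY : ∀ x ∈ Y, ∀ y ∈ Y, x ≠ y → δ ≤ dist x y) : Y.Countable := by
  have h : Y = ⋃ n : ℕ, (closedBall (0 : E) n ∩ Y) := by
    ext y
    simp only [mem_iUnion, mem_inter_iff, mem_closedBall, dist_zero_right]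
    exact ⟨fun hy => ⟨⌈‖y‖⌉₊, Nat.le_ceil _, hy⟩, fun ⟨_, _, hy⟩ => hy⟩
  rw [h]
  exact Set.countable_iUnion fun n =>
    (Literature.Probability.Process.LocalConfig.finite_inter_of_separated hδ hY
      (isCompact_closedBall _ _)).countable

end Countable

section Measurable

variable {E : Type*} [NormedAddCommGroup E] [NormedSpace ℝ E] [MeasurableSpace E]

/-- The orbit class of a point of a countable `Y` is measurable as soon as the rooted classes are. -/
theorem measurableSet_klass {Y : Set E} (hYc : Y.Countable)
    (hmeas : ∀ q : E, MeasurableSet {μ : Measure E | ∃ A : E →ₗᵢ[ℝ] E,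
      μ = (Measure.count : Measure E).restrict ((fun s => A (s - q)) '' Y)})
    {b : E} (hb : b ∈ Y) :
    MeasurableSet {ν : Measure E | ∃ p ∈ {t | ∃ g : E ≃ᵢ E, g '' Y = Y ∧ g b = t}, ν ∈ {μ | ∃ A : E →ₗᵢ[ℝ] E,
      μ = (Measure.count : Measure E).restrict ((fun s => A (s - p)) '' Y)}} := by
  have h : {ν : Measure E | ∃ p ∈ {t | ∃ g : E ≃ᵢ E, g '' Y = Y ∧ g b = t}, ν ∈ {μ | ∃ A : E →ₗᵢ[ℝ] E,
      μ = (Measure.count : Measure E).restrict ((fun s => A (s - p)) '' Y)}} =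
      ⋃ p ∈ {t | ∃ g : E ≃ᵢ E, g '' Y = Y ∧ g b = t}, {μ | ∃ A : E →ₗᵢ[ℝ] E,
        μ = (Measure.count : Measure E).restrict ((fun s => A (s - p)) '' Y)} := by
    ext ν
    simp only [mem_setOf_eq, mem_iUnion, exists_prop]
  rw [h]
  exact MeasurableSet.biUnion (hYc.mono (orbit_subset hb)) fun p _ => hmeas p

variable [MeasurableSingletonClass E]

omit [NormedAddCommGroup E] [NormedSpace ℝ E] in
/-- Every set is null-measurable for the counting measure of a countable set. -/
theorem nullMeasurableSet_count_restrict {Z : Set E} (hZ : Z.Countable) (W : Set E) :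
    NullMeasurableSet W ((Measure.count : Measure E).restrict Z) := by
  rw [← Set.inter_union_sdiff W Z]
  refine ((hZ.mono inter_subset_right).measurableSet.nullMeasurableSet).union
    (NullMeasurableSet.of_null ?_)
  rw [Measure.restrict_apply' hZ.measurableSet]
  simp

end Measurable

section Indicator

/-- Product of two indicators of `1` (in `ℝ≥0∞`) as one indicator. -/
theorem indicator_one_mul_indicator_one {α β : Type*} (S : Set α) (T : Set β) (f : β → α) (y : β) :
    S.indicator (1 : α → ℝ≥0∞) (f y) * T.indicator (1 : β → ℝ≥0∞) y = {x | f x ∈ S ∧ x ∈ T}.indicator 1 y := by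
  by_cases h1 : f y ∈ S <;> by_cases h2 : y ∈ T <;> simp [h1, h2]

/-- The indicator of the closed ball `B̄(0, r)` is even. -/
theorem indicator_closedBall_neg {E : Type*} [SeminormedAddCommGroup E] (r : ℝ) (y : E) :
    (Metric.closedBall (0 : E) r).indicator (1 : E → ℝ≥0∞) (-y) = (Metric.closedBall (0 : E) r).indicator 1 y := by
  by_cases h : y ∈ Metric.closedBall (0 : E) r
  · have h' : -y ∈ Metric.closedBall (0 : E) r := by rwa [mem_closedBall_zero_iff, norm_neg, ← mem_closedBall_zero_iff]
    rw [Set.indicator_of_mem h, Set.indicator_of_mem h', Pi.one_apply, Pi.one_apply]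
  · have h' : -y ∉ Metric.closedBall (0 : E) r := by rwa [mem_closedBall_zero_iff, norm_neg, ← mem_closedBall_zero_iff]
    rw [Set.indicator_of_notMem h, Set.indicator_of_notMem h']

end Indicator

/-! ## The Mecke identity between orbit classes -/

section Mecke

variable {E : Type*} [NormedAddCommGroup E] [NormedSpace ℝ E] [FiniteDimensional ℝ E]
  [MeasurableSpace E] [BorelSpace E]

/-- **Atoms sent to an orbit class, counted**: for the copy `ν = count|A(Y - q)` of a `δ`-separated
`Y` and `b ∈ Y`, `∫⁻ y, 1[θ_y ν ∈ K b] 1[‖y‖ ≤ r] dν = #(orbit b ∩ B̄(q, r))`. -/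
theorem lintegral_indicator_klass_eq {Y : Set E} {δ : ℝ} (hδ : 0 < δ)
    (hY : ∀ x ∈ Y, ∀ y ∈ Y, x ≠ y → δ ≤ dist x y) {b : E} (hb : b ∈ Y) (A : E →ₗᵢ[ℝ] E) (q : E) (r : ℝ) :
    ∫⁻ y, {ν : Measure E | ∃ p ∈ {t | ∃ g : E ≃ᵢ E, g '' Y = Y ∧ g b = t}, ν ∈ {μ | ∃ A : E →ₗᵢ[ℝ] E,
          μ = (Measure.count : Measure E).restrict ((fun s => A (s - p)) '' Y)}}.indicator 1
          (((Measure.count : Measure E).restrict ((fun s => A (s - q)) '' Y)).map (fun z => z - y)) *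
        (closedBall (0 : E) r).indicator 1 y ∂((Measure.count : Measure E).restrict ((fun s => A (s - q)) '' Y)) =
      (({t | ∃ g : E ≃ᵢ E, g '' Y = Y ∧ g b = t} ∩ closedBall q r).ncard : ℝ≥0∞) := by
  have hYc : Y.Countable := countable_of_forall_le_dist hδ hY
  have hZc : ((fun s => A (s - q)) '' Y).Countable := hYc.image _
  have hF : (fun y => {ν : Measure E | ∃ p ∈ {t | ∃ g : E ≃ᵢ E, g '' Y = Y ∧ g b = t}, ν ∈ {μ | ∃ A : E →ₗᵢ[ℝ] E,
          μ = (Measure.count : Measure E).restrict ((fun s => A (s - p)) '' Y)}}.indicator (1 : Measure E → ℝ≥0∞)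
          (((Measure.count : Measure E).restrict ((fun s => A (s - q)) '' Y)).map (fun z => z - y)) *
        (closedBall (0 : E) r).indicator 1 y) =
      {y | ((Measure.count : Measure E).restrict ((fun s => A (s - q)) '' Y)).map (fun z => z - y) ∈
        {ν : Measure E | ∃ p ∈ {t | ∃ g : E ≃ᵢ E, g '' Y = Y ∧ g b = t}, ν ∈ {μ | ∃ A : E →ₗᵢ[ℝ] E,
          μ = (Measure.count : Measure E).restrict ((fun s => A (s - p)) '' Y)}} ∧
        y ∈ closedBall (0 : E) r}.indicator 1 :=
    funext fun y => indicator_one_mul_indicator_one _ _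
      (fun y => ((Measure.count : Measure E).restrict ((fun s => A (s - q)) '' Y)).map (fun z => z - y)) y
  rw [hF, lintegral_indicator_one₀ (nullMeasurableSet_count_restrict hZc _),
    Measure.restrict_apply' hZc.measurableSet, atoms_inter_eq_image hb A q r]
  have hfin : ({t | ∃ g : E ≃ᵢ E, g '' Y = Y ∧ g b = t} ∩ closedBall q r).Finite :=
    finite_orbit_inter_closedBall hδ hY hb q r
  have hinj : Function.Injective fun s : E => A (s - q) := fun _ _ hst => sub_left_injective (A.injective hst)
  rw [Measure.count_apply_finite _ (hfin.image _), ← Set.ncard_eq_toFinset_card _ (hfin.image _),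
    Set.ncard_image_of_injective _ hinj]

/-- **The inner Mecke integral**: for every configuration `μ` and `c, d ∈ Y`,
`∫⁻ y, 1[μ ∈ K c] 1[θ_y μ ∈ K d] 1[‖y‖ ≤ r] dμ = 1[μ ∈ K c] · #(orbit d ∩ B̄(c, r))`. -/
theorem lintegral_inner_eq {Y : Set E} {δ : ℝ} (hδ : 0 < δ)
    (hY : ∀ x ∈ Y, ∀ y ∈ Y, x ≠ y → δ ≤ dist x y) {c d : E} (hd : d ∈ Y) (r : ℝ)
    (μ : Measure E) :
    ∫⁻ y, {ν : Measure E | ∃ p ∈ {t | ∃ g : E ≃ᵢ E, g '' Y = Y ∧ g c = t}, ν ∈ {μ | ∃ A : E →ₗᵢ[ℝ] E,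
          μ = (Measure.count : Measure E).restrict ((fun s => A (s - p)) '' Y)}}.indicator 1 μ *
        ({ν : Measure E | ∃ p ∈ {t | ∃ g : E ≃ᵢ E, g '' Y = Y ∧ g d = t}, ν ∈ {μ | ∃ A : E →ₗᵢ[ℝ] E,
          μ = (Measure.count : Measure E).restrict ((fun s => A (s - p)) '' Y)}}.indicator 1
          (μ.map (fun z => z - y)) * (closedBall (0 : E) r).indicator 1 y) ∂μ =
      {ν : Measure E | ∃ p ∈ {t | ∃ g : E ≃ᵢ E, g '' Y = Y ∧ g c = t}, ν ∈ {μ | ∃ A : E →ₗᵢ[ℝ] E,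
          μ = (Measure.count : Measure E).restrict ((fun s => A (s - p)) '' Y)}}.indicator 1 μ *
        (({t | ∃ g : E ≃ᵢ E, g '' Y = Y ∧ g d = t} ∩ closedBall c r).ncard : ℝ≥0∞) := by
  by_cases hμ : μ ∈ {ν : Measure E | ∃ p ∈ {t | ∃ g : E ≃ᵢ E, g '' Y = Y ∧ g c = t}, ν ∈ {μ | ∃ A : E →ₗᵢ[ℝ] E,
      μ = (Measure.count : Measure E).restrict ((fun s => A (s - p)) '' Y)}}
  · rw [Set.indicator_of_mem hμ]
    obtain ⟨q, hq, A, rfl⟩ := hμ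
    simp only [Pi.one_apply, one_mul]
    rw [lintegral_indicator_klass_eq hδ hY hd A q r, ncard_orbit_inter_closedBall_eq hq d r]
  · rw [Set.indicator_of_notMem hμ]
    simp only [zero_mul, lintegral_zero]

/-- **Mecke between orbit classes**: for a point-stationary law `P` almost surely `δ`-hard-core,
a `δ`-separated `Y` with measurable rooted classes and `a, b ∈ Y`,
`#(orbit b ∩ B̄(a, r)) · P(K a) = #(orbit a ∩ B̄(b, r)) · P(K b)`. -/
theorem ncard_mul_measure_klass_eq {Y : Set E} {δ : ℝ} (hδ : 0 < δ)
    (hY : ∀ x ∈ Y, ∀ y ∈ Y, x ≠ y → δ ≤ dist x y)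
    (hmeas : ∀ q : E, MeasurableSet {μ : Measure E | ∃ A : E →ₗᵢ[ℝ] E,
      μ = (Measure.count : Measure E).restrict ((fun s => A (s - q)) '' Y)})
    {P : Measure (Measure E)} (hcore : ∀ᵐ μ ∂P, IsRootedHardCore δ μ) (hstat : IsPointStationaryLaw P)
    {a b : E} (ha : a ∈ Y) (hb : b ∈ Y) (r : ℝ) :
    (({t | ∃ g : E ≃ᵢ E, g '' Y = Y ∧ g b = t} ∩ closedBall a r).ncard : ℝ≥0∞) *
        P {ν : Measure E | ∃ p ∈ {t | ∃ g : E ≃ᵢ E, g '' Y = Y ∧ g a = t}, ν ∈ {μ | ∃ A : E →ₗᵢ[ℝ] E,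
          μ = (Measure.count : Measure E).restrict ((fun s => A (s - p)) '' Y)}} =
      (({t | ∃ g : E ≃ᵢ E, g '' Y = Y ∧ g a = t} ∩ closedBall b r).ncard : ℝ≥0∞) *
        P {ν : Measure E | ∃ p ∈ {t | ∃ g : E ≃ᵢ E, g '' Y = Y ∧ g b = t}, ν ∈ {μ | ∃ A : E →ₗᵢ[ℝ] E,
          μ = (Measure.count : Measure E).restrict ((fun s => A (s - p)) '' Y)}} := by
  -- an s-finite kernel agreeing with the identity on locally finite configurations
  obtain ⟨κ, hκ, hκid⟩ := exists_isSFiniteKernel_apply_eq_self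
    (fun n : ℕ => (fun z : E => ⌊‖z‖⌋₊) ⁻¹' {n}) measurableSet_floorNorm_preimage
    (fun i j hij => Set.disjoint_iff.2 fun z hz => hij (hz.1.symm.trans hz.2))
    (fun z => ⟨⌊‖z‖⌋₊, rfl⟩)
  haveI := hκ
  have hYc : Y.Countable := countable_of_forall_le_dist hδ hY
  have hKa := measurableSet_klass hYc hmeas ha
  have hKb := measurableSet_klass hYc hmeas hb
  have hfix : ∀ μ : Measure E, IsRootedHardCore δ μ → κ μ = μ := fun μ hμ => by
    obtain ⟨S, -, hS, rfl⟩ := hμ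
    exact hκid _ (count_restrict_floorNorm_preimage_lt_top hδ hS)
  -- the transport
  set Ka := {ν : Measure E | ∃ p ∈ {t | ∃ g : E ≃ᵢ E, g '' Y = Y ∧ g a = t}, ν ∈ {μ | ∃ A : E →ₗᵢ[ℝ] E,
      μ = (Measure.count : Measure E).restrict ((fun s => A (s - p)) '' Y)}} with hKa_def
  set Kb := {ν : Measure E | ∃ p ∈ {t | ∃ g : E ≃ᵢ E, g '' Y = Y ∧ g b = t}, ν ∈ {μ | ∃ A : E →ₗᵢ[ℝ] E,
      μ = (Measure.count : Measure E).restrict ((fun s => A (s - p)) '' Y)}} with hKb_def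
  obtain ⟨g, hg⟩ : ∃ g : Measure E → E → ℝ≥0∞, g = fun μ y =>
      Ka.indicator 1 μ * (Kb.indicator 1 ((κ μ).map (fun z => z - y)) * (closedBall (0 : E) r).indicator 1 y) :=
    ⟨_, rfl⟩
  have hgm : Measurable (Function.uncurry g) := by
    rw [hg]
    exact ((measurable_one.indicator hKa).comp measurable_fst).mul
      (((measurable_one.indicator hKb).comp (measurable_map_sub_kernel κ)).mul
        ((measurable_one.indicator measurableSet_closedBall).comp measurable_snd))
  have hM := hstat g hgm
  -- mass sent: `n(a, b, r) · P(K a)`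
  have hL : ∫⁻ μ, ∫⁻ y, g μ y ∂μ ∂P =
      (({t | ∃ g : E ≃ᵢ E, g '' Y = Y ∧ g b = t} ∩ closedBall a r).ncard : ℝ≥0∞) * P Ka := by
    have h1 : ∫⁻ μ, ∫⁻ y, g μ y ∂μ ∂P =
        ∫⁻ μ, Ka.indicator 1 μ * (({t | ∃ g : E ≃ᵢ E, g '' Y = Y ∧ g b = t} ∩ closedBall a r).ncard : ℝ≥0∞) ∂P := by
      refine lintegral_congr_ae (hcore.mono fun μ hμ => ?_)
      dsimp only
      simp only [hg, hfix μ hμ]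
      exact lintegral_inner_eq hδ hY hb r μ
    rw [h1, lintegral_mul_const _ (measurable_one.indicator hKa), lintegral_indicator_one hKa, mul_comm]
  -- mass received: `n(b, a, r) · P(K b)`
  have hR : ∫⁻ μ, ∫⁻ y, g (μ.map (fun z => z - y)) (-y) ∂μ ∂P =
      (({t | ∃ g : E ≃ᵢ E, g '' Y = Y ∧ g a = t} ∩ closedBall b r).ncard : ℝ≥0∞) * P Kb := by
    have h1 : ∫⁻ μ, ∫⁻ y, g (μ.map (fun z => z - y)) (-y) ∂μ ∂P =
        ∫⁻ μ, Kb.indicator 1 μ * (({t | ∃ g : E ≃ᵢ E, g '' Y = Y ∧ g a = t} ∩ closedBall b r).ncard : ℝ≥0∞) ∂P := by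
      refine lintegral_congr_ae (hcore.mono fun μ hμ => ?_)
      dsimp only
      have hμ' := hμ
      obtain ⟨S, -, hS, rfl⟩ := hμ'
      have hSm : MeasurableSet S := (countable_of_forall_le_dist hδ hS).measurableSet
      have h2 : ∫⁻ y, g (((Measure.count : Measure E).restrict S).map (fun z => z - y)) (-y)
            ∂((Measure.count : Measure E).restrict S) =
          ∫⁻ y in S, Kb.indicator 1 ((Measure.count : Measure E).restrict S) *
            (Ka.indicator 1 (((Measure.count : Measure E).restrict S).map (fun z => z - y)) *
              (closedBall (0 : E) r).indicator 1 y) ∂(Measure.count : Measure E) := by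
        refine lintegral_congr_ae ((ae_restrict_iff' hSm).2 (Filter.Eventually.of_forall fun y hy => ?_))
        dsimp only
        have hy' : (Measure.count : Measure E).restrict S {y} ≠ 0 :=
          (count_restrict_singleton_ne_zero_iff S y).2 hy
        have hhc : IsRootedHardCore δ (((Measure.count : Measure E).restrict S).map (fun z => z - y)) :=
          hμ.map_sub hy'
        simp only [hg, hfix _ hhc]
        rw [Measure.map_map (measurable_sub_const (-y)) (measurable_sub_const y)]
        have hcomp : ((fun z : E => z - -y) ∘ fun z => z - y) = id := by
          funext z
          simp
        rw [hcomp, Measure.map_id]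
        rw [indicator_closedBall_neg r y]
        ring
      rw [h2]
      exact lintegral_inner_eq hδ hY ha r _
    rw [h1, lintegral_mul_const _ (measurable_one.indicator hKb), lintegral_indicator_one hKb, mul_comm]
  rw [← hL, hM, hR]

/-- **The mass formula**: for a point-stationary law `P` almost surely `δ`-hard-core and a
`δ`-separated `Y` with measurable rooted classes and finitely many symmetries moving a point of
norm `≤ R` to a point of norm `≤ R` (every `R`), the masses of the orbit classes satisfy
`P(K a) · |Stab a| = P(K b) · |Stab b|` for all `a, b ∈ Y`. -/
theorem measure_klass_mul_card_stab_eq {Y : Set E} {δ : ℝ} (hδ : 0 < δ)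
    (hY : ∀ x ∈ Y, ∀ y ∈ Y, x ≠ y → δ ≤ dist x y)
    (hmeas : ∀ q : E, MeasurableSet {μ : Measure E | ∃ A : E →ₗᵢ[ℝ] E,
      μ = (Measure.count : Measure E).restrict ((fun s => A (s - q)) '' Y)})
    (hfin : ∀ R : ℝ, {g : E ≃ᵢ E | g '' Y = Y ∧ ∃ x : E, ‖x‖ ≤ R ∧ ‖g x‖ ≤ R}.Finite)
    {P : Measure (Measure E)} (hcore : ∀ᵐ μ ∂P, IsRootedHardCore δ μ) (hstat : IsPointStationaryLaw P)
    {a b : E} (ha : a ∈ Y) (hb : b ∈ Y) :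
    P {ν : Measure E | ∃ p ∈ {t | ∃ g : E ≃ᵢ E, g '' Y = Y ∧ g a = t}, ν ∈ {μ | ∃ A : E →ₗᵢ[ℝ] E,
          μ = (Measure.count : Measure E).restrict ((fun s => A (s - p)) '' Y)}} *
        (Nat.card {g : E ≃ᵢ E // g '' Y = Y ∧ g a = a} : ℝ≥0∞) =
      P {ν : Measure E | ∃ p ∈ {t | ∃ g : E ≃ᵢ E, g '' Y = Y ∧ g b = t}, ν ∈ {μ | ∃ A : E →ₗᵢ[ℝ] E,
          μ = (Measure.count : Measure E).restrict ((fun s => A (s - p)) '' Y)}} *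
        (Nat.card {g : E ≃ᵢ E // g '' Y = Y ∧ g b = b} : ℝ≥0∞) := by
  have hN := card_moves_pos hfin a b
  have h1 := card_moves_eq Y a b (dist b a)
  have h2 := card_moves_eq Y b a (dist b a)
  have h3 := card_moves_symm Y a b (dist b a)
  have hM := ncard_mul_measure_klass_eq hδ hY hmeas hcore hstat ha hb (dist b a)
  set N := Nat.card {g : E ≃ᵢ E // g '' Y = Y ∧ dist (g b) a ≤ dist b a} with hN_def
  set sa := Nat.card {g : E ≃ᵢ E // g '' Y = Y ∧ g a = a}
  set sb := Nat.card {g : E ≃ᵢ E // g '' Y = Y ∧ g b = b}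
  set nab := ({t | ∃ g : E ≃ᵢ E, g '' Y = Y ∧ g b = t} ∩ closedBall a (dist b a)).ncard
  set nba := ({t | ∃ g : E ≃ᵢ E, g '' Y = Y ∧ g a = t} ∩ closedBall b (dist b a)).ncard
  set pa := P {ν : Measure E | ∃ p ∈ {t | ∃ g : E ≃ᵢ E, g '' Y = Y ∧ g a = t}, ν ∈ {μ | ∃ A : E →ₗᵢ[ℝ] E,
          μ = (Measure.count : Measure E).restrict ((fun s => A (s - p)) '' Y)}}
  set pb := P {ν : Measure E | ∃ p ∈ {t | ∃ g : E ≃ᵢ E, g '' Y = Y ∧ g b = t}, ν ∈ {μ | ∃ A : E →ₗᵢ[ℝ] E,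
          μ = (Measure.count : Measure E).restrict ((fun s => A (s - p)) '' Y)}}
  have key : (N : ℝ≥0∞) * (pa * sa) = (N : ℝ≥0∞) * (pb * sb) := by
    calc (N : ℝ≥0∞) * (pa * sa) = ((nab * sb : ℕ) : ℝ≥0∞) * (pa * sa) := by rw [h1]
      _ = ((nab : ℝ≥0∞) * pa) * ((sa : ℝ≥0∞) * sb) := by push_cast; ring
      _ = ((nba : ℝ≥0∞) * pb) * ((sa : ℝ≥0∞) * sb) := by rw [hM]
      _ = ((nba * sa : ℕ) : ℝ≥0∞) * (pb * sb) := by push_cast; ring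
      _ = (N : ℝ≥0∞) * (pb * sb) := by rw [← h2, ← h3]
  exact (ENNReal.mul_right_inj (by exact_mod_cast hN.ne') (ENNReal.natCast_ne_top N)).1 key

end Mecke

/-! ## Anchor (registered helper statement) -/

/-- **Registered helper** `finiteOrbits_massFormula` (anchor of this file): the mass formula in `ℝ³`.
For a point-stationary law `P` on configurations of `ℝ³`, almost surely rooted `δ`-hard-core, and a
`δ`-separated `Y` whose rooted isometry classes are measurable and whose symmetries moving a point of
norm `≤ R` to a point of norm `≤ R` are finitely many for every `R`: for all `a, b ∈ Y`,
`P(K a) · |Stab a| = P(K b) · |Stab b|`, where `K a` is the set of copies `count|A(Y - p)` rooted at a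
point `p` of the symmetry orbit of `a` and `Stab a = {g | g '' Y = Y ∧ g a = a}`. -/
theorem finiteOrbits_massFormula : ∀ (δ : ℝ), 0 < δ → ∀ (Y : Set (EuclideanSpace ℝ (Fin 3))), (∀ x ∈ Y, ∀ y ∈ Y, x ≠ y → δ ≤ dist x y) → (∀ q : EuclideanSpace ℝ (Fin 3), MeasurableSet {μ : MeasureTheory.Measure (EuclideanSpace ℝ (Fin 3)) | ∃ A : EuclideanSpace ℝ (Fin 3) →ₗᵢ[ℝ] EuclideanSpace ℝ (Fin 3), μ = (MeasureTheory.Measure.count : MeasureTheory.Measure (EuclideanSpace ℝ (Fin 3))).restrict ((fun s => A (s - q)) '' Y)}) → (∀ R : ℝ, {g : EuclideanSpace ℝ (Fin 3) ≃ᵢ EuclideanSpace ℝ (Fin 3) | g '' Y = Y ∧ ∃ x : EuclideanSpace ℝ (Fin 3), ‖x‖ ≤ R ∧ ‖g x‖ ≤ R}.Finite) → ∀ (P : MeasureTheory.Measure (MeasureTheory.Measure (EuclideanSpace ℝ (Fin 3)))), (∀ᵐ μ ∂P, Literature.Probability.Process.IsRootedHardCore δ μ) → Literature.Probability.Process.IsPointStationaryLaw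 P → ∀ a ∈ Y, ∀ b ∈ Y, P {ν : MeasureTheory.Measure (EuclideanSpace ℝ (Fin 3)) | ∃ p ∈ {t : EuclideanSpace ℝ (Fin 3) | ∃ g : EuclideanSpace ℝ (Fin 3) ≃ᵢ EuclideanSpace ℝ (Fin 3), g '' Y = Y ∧ g a = t}, ν ∈ {μ : MeasureTheory.Measure (EuclideanSpace ℝ (Fin 3)) | ∃ A : EuclideanSpace ℝ (Fin 3) →ₗᵢ[ℝ] EuclideanSpace ℝ (Fin 3), μ = (MeasureTheory.Measure.count : MeasureTheory.Measure (EuclideanSpace ℝ (Fin 3))).restrict ((fun s => A (s - p)) '' Y)}} * (Nat.card {g : EuclideanSpace ℝ (Fin 3) ≃ᵢ EuclideanSpace ℝ (Fin 3) // g '' Y = Y ∧ g a = a} : ENNReal) = P {ν : MeasureTheory.Measure (EuclideanSpace ℝ (Fin 3)) | ∃ p ∈ {t : EuclideanSpace ℝ (Fin 3) | ∃ g : EuclideanSpace ℝ (Fin 3) ≃ᵢ EuclideanSpace ℝ (Fin 3), g '' Y = Y ∧ g b = t}, ν ∈ {μ : MeasureTheory.Measure (EuclideanSpace ℝ (Fin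 3)) | ∃ A : EuclideanSpace ℝ (Fin 3) →ₗᵢ[ℝ] EuclideanSpace ℝ (Fin 3), μ = (MeasureTheory.Measure.count : MeasureTheory.Measure (EuclideanSpace ℝ (Fin 3))).restrict ((fun s => A (s - p)) '' Y)}} * (Nat.card {g : EuclideanSpace ℝ (Fin 3) ≃ᵢ EuclideanSpace ℝ (Fin 3) // g '' Y = Y ∧ g b = b} : ENNReal) := by
  intro δ hδ Y hY hmeas hfin P hcore hstat a ha b hb
  exact measure_klass_mul_card_stab_eq hδ hY hmeas hfin hcore hstat ha hb

end Summit.AtomisticToContinuum.Crystallization.Theorems.IsometryAtomsMinimisingLawsCohesive.FiniteOrbitsOfCharged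

end
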